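import Literature.Barriers.CriticalPhenomena.RigorousRGSmallParameterDualTestFunctionBounds
import Literature.Barriers.CriticalPhenomena.RigorousRGSmallParameterMonomialNorms
import Literature.Barriers.CriticalPhenomena.RigorousRGSmallParameterGradedNilpotentInverse
import Literature.Barriers.CriticalPhenomena.RigorousRGSmallParameterLocProperties
import HarnessLib

/-!
# `RigorousRGSmallParameter` (Slade, Theorem 1.4.1): [BS-rg-loc] Proposition 1.4.5 / (prop:LTsymXYbd)
# — `‖Loc_{X,Y}F‖_{T_0(𝔥,R)} ≤ C̄'(|Y|/|X|)‖F‖_{T_0(𝔥,R)}` with an explicit `C̄'`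

Companion ("proof architecture") file of
`Literature/Barriers/CriticalPhenomena/RigorousRGSmallParameter.lean` (Loc norm-estimates layer;
the boundedness of `Loc` in `T_0`, first of the two norm estimates behind the contraction of `K` in
Slade's Theorem 6.3.1). [BS-rg-loc] Proposition 1.4.5: "`‖Loc_X F‖_{T_0} ≤ C̄'‖F‖_{T_0}`"; §2.2,
proof of Propositions (prop:Locbd)/(prop:LTsymXYbd): "`Loc_{X,Y}F = Σ_{m,m'}⟨F,f_{m'}^{(a)}⟩_0
B^{-1}_{m',m}P̂_m(Y)`. Hence, writing `A = |X|^{-1}B`, and estimating the norm of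
`P̂_m(Y) = Σ_{y∈Y}P̂_{m,y}` by the triangle inequality, `‖Loc_{X,Y}F‖_{T_0} ≤ ‖F‖_{T_0}(|Y|/|X|)
Σ_{m,m'}‖f_{m'}^{(a)}‖_{Φ(U)}|A^{-1}_{m',m}|‖P̂_{m,0}‖_{T_0}` (e:LTXYB5) … it suffices to show
`|A^{-1}_{m'm}| ≤ C̄𝔥^{m'}R^{-|α(m')|₁}R^{|α(m)|₁}𝔥^{-m}` (e:Ainvbd)". This file PROVES the
proposition for the tree's `locXY` (`…LocProperties`), assembling `…MonomialNorms` (Lemma 3.2.2),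
`…DualTestFunctionBounds` (Lemma 3.3.2 with (e:FXbd)) and `…GradedNilpotentInverse` ((e:Ainv)): with
the weights `w(C) = 𝔥^{p(C)}R^{-|α(C)|₁}`, `N = |X|^{-1}B - I` is graded-nilpotent in the dimension
with `|N_{C'C}| ≤ K₀w(C')/w(C)`, hence `|B^{-1}_{C'C}| ≤ |X|^{-1}sGeo·w(C')/w(C)`,
`|β_C| ≤ ‖F‖_{T_0}|X|^{-1}sGeo K₀/w(C)`, and **`‖Loc_{X,Y}F‖_{T_0} ≤ locBdConst·(|Y|/|X|)·‖F‖_{T_0}`**,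
`locBdConst = |𝔳_+|·sGeo·K₀` (all powers of `𝔥, R` cancel; `K₀ = Σ_C tayXConst(C)w(C)` is `O(1)`
when the box radius `a₀` and cutoff width `w` are `≍ R`). Hypotheses: `LocAdm`, `X ≠ ∅` in the
coordinate patch with its `⌊d_+⌋`-reach inside the box of radius `a₀` about `a`, `F ∈ 𝒩(U)` with
`U` in that box, `⌊d_+⌋ ≤ p_Φ`, and the window/wrap-free size conditions on `M`. All PROVED, 0 sorry:

* `TphiNorm_phatX_zero_le` (`‖P̂_m(Y)‖_{T_0} ≤ |Y|𝔥^pR^{-|α|₁}`); setting: `wtC`, `xC`, `kZero`,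
  `nMat`, `gradeC`, `sGeo`, `locBdConst`; `wtC_pos`, `Bmat_eq_smul`, `nMat_eq_zero_of_dim_le`,
  `gradeC_lt_of_dim_lt`, `nMat_graded`, `boxSet`, `reach_subset_boxSet`, **`abs_nMat_le`**,
  **`abs_Bmat_inv_le`** ((e:Ainvbd)), `abs_alphaVec_le`, **`abs_betaVec_le`**,
  **`TphiNorm_locXY_zero_le`** (Proposition 1.4.5 / (prop:LTsymXYbd)).

Sources: D. C. Brydges, G. Slade, *A renormalisation group method. II. Approximation by local
polynomials*, J. Stat. Phys. 159 (2015) 461–491, arXiv:1403.7253, Proposition 1.4.5,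
Proposition (prop:LTsymXYbd) (§1.7), §2.2 (displays (e:LTXYB5), (e:PhatPhibd), (e:Ainv), (e:Ainvbd)),
TeX-source numbering.

## References

* [BrydgesSlade2015RGII] D. C. Brydges, G. Slade, *A renormalisation group method. II.
  Approximation by local polynomials*, J. Stat. Phys. **159** (2015) 461–491, arXiv:1403.7253.
-/

noncomputable section

namespace Literature.Barriers.CriticalPhenomena

namespace LongRangePhi4

namespace Loc

open Finset Tphi RGNorm LocalPoly Bump Polymer GradedNilpotent Literature.Probability.LatticeModels Matrix
open scoped ContDiff

variable {d M n : ℕ} [NeZero M]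

/-! ### Norms of `P̂_m(Y)` -/

/-- **`‖P̂_m(Y)‖_{T_0(𝔥,R)} ≤ |Y| 𝔥^{p(m)} R^{-|α(m)|₁}`** (Lemma 3.2.2 summed over `Y`, "estimating the norm
of `P̂_m(Y) = Σ_{y∈Y} P̂_{m,y}` by the triangle inequality"). [cite: BrydgesSlade2015RGII, §2.2 (proof of Propositions (prop:Locbd)/(prop:LTsymXYbd)) and Lemma 3.2.2] -/
theorem TphiNorm_phatX_zero_le {𝔥 R : ℝ} (h𝔥 : 0 < 𝔥) (hR : 0 < R) {pΦ pN : ℕ} (hpN : 1 ≤ pN)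
    (m' : List (Fin n × List (Fin d))) (hm : ∀ c ∈ m', c.2.length ≤ pΦ) (Y : Finset (TorusSite d M)) :
    TphiNorm pN (latticeFamily (unitStep d M) 𝔥 R pΦ) (basisDir d M n) (phatX m' Y) 0 ≤
      Y.card * (𝔥 ^ m'.length * (R ^ tordF m')⁻¹) := by
  have e : coeffFamily (basisDir d M n) (phatX (n := n) m' Y) 0 =
      fun z => ∑ y ∈ Y, coeffFamily (basisDir d M n) (phat m' y) 0 z := by
    funext z
    simp only [coeffFamily]
    rw [show phatX (n := n) m' Y = fun φ => ∑ y ∈ Y, phat m' y φ from rfl,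
      coeff_finset_sum _ Y (fun y _ => contDiff_phat m' y) z]
  unfold TphiNorm
  rw [e]
  refine (Tnorm_sum_le (latticeFamily_evalBound (unitStep d M) h𝔥 hR pΦ pN (ι := Fin n)) Y _).trans ?_
  rw [show (Y.card : ℝ) * (𝔥 ^ m'.length * (R ^ tordF m')⁻¹) = ∑ _y ∈ Y, 𝔥 ^ m'.length * (R ^ tordF m')⁻¹ by
    rw [Finset.sum_const, nsmul_eq_mul]]
  exact Finset.sum_le_sum fun y _ => TphiNorm_phat_zero_le h𝔥 hR hpN m' hm y

/-! ### The setting of Proposition 1.4.5 -/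

section Setting

variable (pN : ℕ) (dφ dplus : ℝ) (a : TorusSite d M) (X : Finset (TorusSite d M))
variable (a₀ w pΦ : ℕ) (𝔥 R : ℝ)

/-- The weight `w(C) = 𝔥^{p(C)} R^{-|α(C)|₁}` of a class. [cite: BrydgesSlade2015RGII, §2.2 (display (e:Ainvbd))] -/
def wtC (C : vPlus d n dφ dplus) : ℝ := 𝔥 ^ (rep C.1).length * (R ^ tordF (rep C.1))⁻¹

/-- The dimensionless TayX constant `X_C = tayXConst(C) · w(C)`. [folklore] -/
def xC (C : vPlus d n dφ dplus) : ℝ := tayXConst (rep C.1) a₀ w pΦ 𝔥 R * wtC dφ dplus 𝔥 R C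

variable (d n) in
/-- `K₀ = Σ_C X_C`. [folklore] -/
def kZero : ℝ := ∑ C : vPlus d n dφ dplus, xC dφ dplus a₀ w pΦ 𝔥 R C

/-- The nilpotent part `N = |X|^{-1}B - I`. [cite: BrydgesSlade2015RGII, §2.2 ("the upper triangular matrix A - I with zero diagonal is nilpotent")] -/
def nMat : Matrix (vPlus d n dφ dplus) (vPlus d n dφ dplus) ℝ := (X.card : ℝ)⁻¹ • Bmat pN dφ dplus a X - 1

/-- The grading: number of classes of strictly smaller dimension. [folklore] -/
def gradeC (C : vPlus d n dφ dplus) : ℕ := (univ.filter fun C' : vPlus d n dφ dplus => dim dφ (rep C'.1) < dim dφ (rep C.1)).card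

variable (d n) in
/-- The geometric factor `Σ_{k ≤ sup grade} (|𝔳_+| K₀)^k`. [folklore] -/
def sGeo : ℝ := ∑ k ∈ range (univ.sup (gradeC dφ dplus (d := d) (n := n)) + 1),
  (Fintype.card (vPlus d n dφ dplus) * kZero d n dφ dplus a₀ w pΦ 𝔥 R) ^ k

variable (d n) in
/-- The constant `C̄'` of Proposition 1.4.5: `|𝔳_+| · sGeo · K₀`. [cite: BrydgesSlade2015RGII, Proposition 1.4.5 (the constant C̄')] -/
def locBdConst : ℝ := Fintype.card (vPlus d n dφ dplus) * sGeo d n dφ dplus a₀ w pΦ 𝔥 R * kZero d n dφ dplus a₀ w pΦ 𝔥 R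

end Setting

/-! ### The matrix estimates -/

section Estimates

variable {pN : ℕ} {dφ dplus : ℝ} {a : TorusSite d M} {X : Finset (TorusSite d M)}
variable {a₀ w pΦ : ℕ} {𝔥 R : ℝ}

omit [NeZero M] in
/-- The weights are positive. [folklore] -/
theorem wtC_pos (h𝔥 : 0 < 𝔥) (hR : 0 < R) (C : vPlus d n dφ dplus) : 0 < wtC dφ dplus 𝔥 R C := by
  unfold wtC; positivity

/-- `B = |X|(1 + N)`. [folklore] -/
theorem Bmat_eq_smul (hXne : X.Nonempty) :
    Bmat (n := n) pN dφ dplus a X = (X.card : ℝ) • (1 + nMat pN dφ dplus a X) := by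
  have hc : (X.card : ℝ) ≠ 0 := by exact_mod_cast (Finset.card_pos.2 hXne).ne'
  unfold nMat
  rw [add_sub_cancel, smul_smul, mul_inv_cancel₀ hc, one_smul]

/-- `N_{C'C} = 0` unless `[M_{C'}] < [M_C]`. [cite: BrydgesSlade2015RGII, Lemma 2.1.5 (proof: B triangular with |X| on the diagonal)] -/
theorem nMat_eq_zero_of_dim_le (hA : LocAdm M n pN dφ dplus) (hX : InPatch a ⌊dplus⌋₊ X) (hXne : X.Nonempty)
    (C' C : vPlus d n dφ dplus) (hdim : dim dφ (rep C.1) ≤ dim dφ (rep C'.1)) : nMat pN dφ dplus a X C' C = 0 := by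
  have hc : (X.card : ℝ) ≠ 0 := by exact_mod_cast (Finset.card_pos.2 hXne).ne'
  unfold nMat
  rw [Matrix.sub_apply, Matrix.smul_apply, Bmat_apply_of_dim_le hA hX C' C hdim, smul_eq_mul, ← mul_assoc,
    inv_mul_cancel₀ hc, one_mul, Matrix.one_apply]
  split_ifs <;> simp

omit [NeZero M] in
/-- Strictly smaller dimension gives strictly smaller grade. [folklore] -/
theorem gradeC_lt_of_dim_lt {C' C : vPlus d n dφ dplus} (h : dim dφ (rep C'.1) < dim dφ (rep C.1)) :
    gradeC dφ dplus C' < gradeC dφ dplus C := by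
  unfold gradeC
  refine Finset.card_lt_card ⟨fun C'' hC'' => ?_, ?_⟩
  · rw [Finset.mem_filter] at hC'' ⊢
    exact ⟨hC''.1, hC''.2.trans h⟩
  · rw [Finset.not_subset]
    exact ⟨C', by simp [h], by simp⟩

/-- `N` is graded-nilpotent. [folklore] -/
theorem nMat_graded (hA : LocAdm M n pN dφ dplus) (hX : InPatch a ⌊dplus⌋₊ X) (hXne : X.Nonempty)
    (C' C : vPlus d n dφ dplus) (h : nMat pN dφ dplus a X C' C ≠ 0) : gradeC dφ dplus C' < gradeC dφ dplus C := by
  refine gradeC_lt_of_dim_lt (lt_of_not_ge fun hle => h ?_)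
  exact nMat_eq_zero_of_dim_le hA hX hXne C' C hle

/-- The box `{y | ∀ j, cycDist(a_j, y_j) ≤ a₀}` as a finite set. [folklore] -/
def boxSet (a : TorusSite d M) (a₀ : ℕ) : Finset (TorusSite d M) := univ.filter fun y => ∀ j, cycDist (a j) (y j) ≤ a₀

/-- Reaches of points well inside the box stay in the box. [folklore] -/
theorem reach_subset_boxSet {a x : TorusSite d M} {a₀ K : ℕ} (hx : ∀ j, cycDist (a j) (x j) + K ≤ a₀) :
    reach x K ⊆ boxSet a a₀ := by
  intro y hy
  rw [mem_reach] at hy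
  unfold boxSet
  rw [Finset.mem_filter]
  refine ⟨Finset.mem_univ _, fun j => ?_⟩
  have h1 : (cycDist (x j) (y j) : ℤ) ≤ K := by
    rw [← abs_valMinAbs_sub_eq_cycDist]
    exact hy j
  have h2 := cycDist_triangle (a j) (x j) (y j)
  have := hx j
  omega

/-- **The entry bound `|N_{C'C}| ≤ K₀ w(C')/w(C)`** ("bounded by … `|X|^{-1}|⟨P̂_{m'}(X), f_m^{(a)}⟩_0| ≤
‖P̂_{m',0}‖_{T_0}‖f_m^{(a)}‖_{Φ(X̂)}`"). [cite: BrydgesSlade2015RGII, §2.2 (display (e:Ainvbd1) and Lemma 3.2.2, Lemma 3.3.2)] -/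
theorem abs_nMat_le (hA : LocAdm M n pN dφ dplus) (hX : InPatch a ⌊dplus⌋₊ X) (hXne : X.Nonempty)
    (h𝔥 : 0 < 𝔥) (hR : 0 < R) (hpΦ : ⌊dplus⌋₊ ≤ pΦ) (ha₀ : 1 ≤ a₀) (hw : 1 ≤ w)
    (hwin : 2 * ((a₀ : ℤ) + pΦ * (w - 1 : ℕ)) < (M : ℤ) - 2 * pΦ)
    (hM : ((((a₀ + pΦ * (w - 1) + pΦ : ℕ) : ℤ) + pΦ * ⌊dplus / dφ⌋₊) + pΦ * ⌊dplus / dφ⌋₊ + 1) * 2 ≤ (M : ℤ))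
    (hKM : 2 * ((⌊dplus⌋₊ : ℤ) + 1) < M) (hXbox : ∀ x ∈ X, ∀ j, cycDist (a j) (x j) + ⌊dplus⌋₊ ≤ a₀)
    (C' C : vPlus d n dφ dplus) :
    |nMat pN dφ dplus a X C' C| ≤ kZero d n dφ dplus a₀ w pΦ 𝔥 R * wtC dφ dplus 𝔥 R C' / wtC dφ dplus 𝔥 R C := by
  have hwpos : ∀ C'' : vPlus d n dφ dplus, 0 < wtC dφ dplus 𝔥 R C'' := fun C'' => wtC_pos h𝔥 hR C''
  have hxC_nonneg : ∀ C'' : vPlus d n dφ dplus, 0 ≤ xC dφ dplus a₀ w pΦ 𝔥 R C'' := by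
    intro C''
    unfold xC tayXConst
    have := hwpos C''
    have := dualConst_pos (rep C''.1)
    have : 0 ≤ max 1 (R / (((a₀ + pΦ * (w - 1) + pΦ : ℕ) : ℝ) + 2 * (pΦ * (rep C''.1).length) + tordF (rep C''.1)) + 2 / w * R) :=
      le_trans zero_le_one (le_max_left _ _)
    positivity
  have hK0 : xC dφ dplus a₀ w pΦ 𝔥 R C ≤ kZero d n dφ dplus a₀ w pΦ 𝔥 R :=
    Finset.single_le_sum (fun C'' _ => hxC_nonneg C'') (Finset.mem_univ C)
  by_cases hdim : dim dφ (rep C.1) ≤ dim dφ (rep C'.1)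
  · rw [nMat_eq_zero_of_dim_le hA hX hXne C' C hdim, abs_zero]
    have := hwpos C'; have := hwpos C
    exact div_nonneg (mul_nonneg ((hxC_nonneg C).trans hK0) (hwpos C').le) (hwpos C).le
  · -- the off-diagonal entry is a pairing of `P̂_{rep C'}(X)` with `f_{rep C}^{(a)}`
    have hne : C' ≠ C := fun h => hdim (by rw [h])
    have hc : (X.card : ℝ) ≠ 0 := by exact_mod_cast (Finset.card_pos.2 hXne).ne'
    have hcpos : (0 : ℝ) < X.card := by exact_mod_cast Finset.card_pos.2 hXne
    have e : nMat pN dφ dplus a X C' C = (X.card : ℝ)⁻¹ * TphiPairing pN (basisDir d M n) (phatX (rep C'.1) X) 0 (dualTF a (rep C.1)) := by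
      unfold nMat Bmat
      rw [Matrix.sub_apply, Matrix.smul_apply, Matrix.of_apply, Matrix.one_apply, if_neg hne, sub_zero, smul_eq_mul]
      rfl
    rw [e, abs_mul, abs_inv, abs_of_pos hcpos]
    -- bounds on the two factors
    have hrepC := rep_mem_vbarPlus hA.pos C.2
    have hrepC' := rep_mem_vbarPlus hA.pos C'.2
    obtain ⟨hlenC, hordC⟩ := bounds_of_mem_vbarPlus hrepC
    obtain ⟨hlenC', hordC'⟩ := bounds_of_mem_vbarPlus hrepC'
    have hFX : DependsOn (boxSet a a₀) (phatX (n := n) (rep C'.1) X) :=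
      dependsOn_phatX hKM (fun x hx => reach_subset_boxSet (hXbox x hx)) _ hordC'
    have hMC : ((((a₀ + pΦ * (w - 1) + pΦ : ℕ) : ℤ) + pΦ * (rep C.1).length) + pΦ * (rep C.1).length + 1) * 2 ≤ (M : ℤ) := by
      have : ((rep C.1).length : ℤ) ≤ ⌊dplus / dφ⌋₊ := by exact_mod_cast hlenC
      nlinarith [this, (by positivity : (0:ℤ) ≤ pΦ)]
    have h1 := abs_TphiPairing_dualTF_le (pN := pN) h𝔥 hR a (rep C.1) (hlenC.trans hA.deg_le) ha₀ hw hwin hMC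
      (U := boxSet a a₀) (fun x hx j => by unfold boxSet at hx; rw [Finset.mem_filter] at hx; exact hx.2 j) hFX (contDiff_phatX _ X)
    have h2 := TphiNorm_phatX_zero_le h𝔥 hR hA.one_le (rep C'.1) (fun c hc => (hordC' c hc).trans hpΦ) X (pΦ := pΦ)
    have htay : 0 ≤ tayXConst (rep C.1) a₀ w pΦ 𝔥 R := by
      have := hxC_nonneg C
      unfold xC at this
      exact nonneg_of_mul_nonneg_left (by rwa [mul_comm] at this) (hwpos C) |> fun h => by
        rcases le_or_gt 0 (tayXConst (rep C.1) a₀ w pΦ 𝔥 R) with h' | h'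
        · exact h'
        · exact absurd this (not_le.2 (by rw [mul_comm]; exact mul_neg_of_pos_of_neg (hwpos C) h'))
    calc (X.card : ℝ)⁻¹ * |TphiPairing pN (basisDir d M n) (phatX (rep C'.1) X) 0 (dualTF a (rep C.1))|
        ≤ (X.card : ℝ)⁻¹ * (tayXConst (rep C.1) a₀ w pΦ 𝔥 R * (X.card * (𝔥 ^ (rep C'.1).length * (R ^ tordF (rep C'.1))⁻¹))) := by
          refine mul_le_mul_of_nonneg_left (h1.trans (mul_le_mul_of_nonneg_left h2 htay)) (by positivity)
      _ = xC dφ dplus a₀ w pΦ 𝔥 R C * wtC dφ dplus 𝔥 R C' / wtC dφ dplus 𝔥 R C := by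
          unfold xC wtC
          have := (hwpos C).ne'
          unfold wtC at this
          field_simp
      _ ≤ kZero d n dφ dplus a₀ w pΦ 𝔥 R * wtC dφ dplus 𝔥 R C' / wtC dφ dplus 𝔥 R C := by
          have := hwpos C'; have := hwpos C
          gcongr

/-- **The inverse bound (e:Ainvbd)**: `|B^{-1}_{C'C}| ≤ |X|^{-1} sGeo · w(C')/w(C)`. [cite: BrydgesSlade2015RGII, §2.2 (display (e:Ainvbd))] -/
theorem abs_Bmat_inv_le (hA : LocAdm M n pN dφ dplus) (hX : InPatch a ⌊dplus⌋₊ X) (hXne : X.Nonempty)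
    (h𝔥 : 0 < 𝔥) (hR : 0 < R) (hpΦ : ⌊dplus⌋₊ ≤ pΦ) (ha₀ : 1 ≤ a₀) (hw : 1 ≤ w)
    (hwin : 2 * ((a₀ : ℤ) + pΦ * (w - 1 : ℕ)) < (M : ℤ) - 2 * pΦ)
    (hM : ((((a₀ + pΦ * (w - 1) + pΦ : ℕ) : ℤ) + pΦ * ⌊dplus / dφ⌋₊) + pΦ * ⌊dplus / dφ⌋₊ + 1) * 2 ≤ (M : ℤ))
    (hKM : 2 * ((⌊dplus⌋₊ : ℤ) + 1) < M) (hXbox : ∀ x ∈ X, ∀ j, cycDist (a j) (x j) + ⌊dplus⌋₊ ≤ a₀)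
    (C' C : vPlus d n dφ dplus) :
    |(Bmat pN dφ dplus a X)⁻¹ C' C| ≤
      (X.card : ℝ)⁻¹ * sGeo d n dφ dplus a₀ w pΦ 𝔥 R * wtC dφ dplus 𝔥 R C' / wtC dφ dplus 𝔥 R C := by
  have hc : (X.card : ℝ) ≠ 0 := by exact_mod_cast (Finset.card_pos.2 hXne).ne'
  have hcpos : (0 : ℝ) < X.card := by exact_mod_cast Finset.card_pos.2 hXne
  have hK0 : 0 ≤ kZero d n dφ dplus a₀ w pΦ 𝔥 R := by
    have h := abs_nMat_le hA hX hXne h𝔥 hR hpΦ ha₀ hw hwin hM hKM hXbox C C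
    rw [mul_div_assoc, div_self (wtC_pos h𝔥 hR C).ne', mul_one] at h
    exact (abs_nonneg _).trans h
  rw [Bmat_eq_smul hXne]
  have h := abs_inv_apply_le (nMat_graded hA hX hXne) hK0 (wtC_pos h𝔥 hR)
    (abs_nMat_le hA hX hXne h𝔥 hR hpΦ ha₀ hw hwin hM hKM hXbox) hc C' C
  rw [abs_of_pos hcpos] at h
  exact h

/-- **`|α_C| ≤ tayXConst(C)‖F‖_{T_0}`** for `F ∈ 𝒩(U)`, `U` in the box. [cite: BrydgesSlade2015RGII, §2.2 ((e:FXbd) with Lemma 3.3.2)] -/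
theorem abs_alphaVec_le (hA : LocAdm M n pN dφ dplus) (h𝔥 : 0 < 𝔥) (hR : 0 < R) (ha₀ : 1 ≤ a₀) (hw : 1 ≤ w)
    (hwin : 2 * ((a₀ : ℤ) + pΦ * (w - 1 : ℕ)) < (M : ℤ) - 2 * pΦ)
    (hM : ((((a₀ + pΦ * (w - 1) + pΦ : ℕ) : ℤ) + pΦ * ⌊dplus / dφ⌋₊) + pΦ * ⌊dplus / dφ⌋₊ + 1) * 2 ≤ (M : ℤ))
    {U : Finset (TorusSite d M)} (hU : ∀ x ∈ U, ∀ j, cycDist (a j) (x j) ≤ a₀)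
    {F : (TorusSite d M → Fin n → ℝ) → ℝ} (hFU : DependsOn U F) (hFs : ContDiff ℝ ∞ F) (C : vPlus d n dφ dplus) :
    |alphaVec pN dφ dplus a F C| ≤
      tayXConst (rep C.1) a₀ w pΦ 𝔥 R * TphiNorm pN (latticeFamily (unitStep d M) 𝔥 R pΦ) (basisDir d M n) F 0 := by
  have hrepC := rep_mem_vbarPlus hA.pos C.2
  obtain ⟨hlenC, -⟩ := bounds_of_mem_vbarPlus hrepC
  have hMC : ((((a₀ + pΦ * (w - 1) + pΦ : ℕ) : ℤ) + pΦ * (rep C.1).length) + pΦ * (rep C.1).length + 1) * 2 ≤ (M : ℤ) := by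
    have : ((rep C.1).length : ℤ) ≤ ⌊dplus / dφ⌋₊ := by exact_mod_cast hlenC
    nlinarith [this, (by positivity : (0:ℤ) ≤ pΦ)]
  exact abs_TphiPairing_dualTF_le h𝔥 hR a (rep C.1) (hlenC.trans hA.deg_le) ha₀ hw hwin hMC hU hFU hFs

/-- **`|β_C| ≤ ‖F‖_{T_0}·|X|^{-1}·sGeo·K₀ / w(C)`** (`β = αB^{-1}`). [cite: BrydgesSlade2015RGII, §2.2 (display (e:LTXYB5): the double sum over m, m')] -/
theorem abs_betaVec_le (hA : LocAdm M n pN dφ dplus) (hX : InPatch a ⌊dplus⌋₊ X) (hXne : X.Nonempty)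
    (h𝔥 : 0 < 𝔥) (hR : 0 < R) (hpΦ : ⌊dplus⌋₊ ≤ pΦ) (ha₀ : 1 ≤ a₀) (hw : 1 ≤ w)
    (hwin : 2 * ((a₀ : ℤ) + pΦ * (w - 1 : ℕ)) < (M : ℤ) - 2 * pΦ)
    (hM : ((((a₀ + pΦ * (w - 1) + pΦ : ℕ) : ℤ) + pΦ * ⌊dplus / dφ⌋₊) + pΦ * ⌊dplus / dφ⌋₊ + 1) * 2 ≤ (M : ℤ))
    (hKM : 2 * ((⌊dplus⌋₊ : ℤ) + 1) < M) (hXbox : ∀ x ∈ X, ∀ j, cycDist (a j) (x j) + ⌊dplus⌋₊ ≤ a₀)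
    {U : Finset (TorusSite d M)} (hU : ∀ x ∈ U, ∀ j, cycDist (a j) (x j) ≤ a₀)
    {F : (TorusSite d M → Fin n → ℝ) → ℝ} (hFU : DependsOn U F) (hFs : ContDiff ℝ ∞ F) (C : vPlus d n dφ dplus) :
    |betaVec pN dφ dplus a X F C| ≤
      TphiNorm pN (latticeFamily (unitStep d M) 𝔥 R pΦ) (basisDir d M n) F 0 * (X.card : ℝ)⁻¹ *
        sGeo d n dφ dplus a₀ w pΦ 𝔥 R * kZero d n dφ dplus a₀ w pΦ 𝔥 R / wtC dφ dplus 𝔥 R C := by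
  set T := TphiNorm pN (latticeFamily (unitStep d M) 𝔥 R pΦ) (basisDir d M n) F 0 with hT
  have hT0 : 0 ≤ T := TphiNorm_nonneg _ _ _ _ _
  have hwpos : ∀ C'' : vPlus d n dφ dplus, 0 < wtC dφ dplus 𝔥 R C'' := fun C'' => wtC_pos h𝔥 hR C''
  unfold betaVec
  simp only [Matrix.vecMul, dotProduct]
  calc |∑ C', alphaVec pN dφ dplus a F C' * (Bmat pN dφ dplus a X)⁻¹ C' C|
      ≤ ∑ C', |alphaVec pN dφ dplus a F C'| * |(Bmat pN dφ dplus a X)⁻¹ C' C| :=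
        (Finset.abs_sum_le_sum_abs _ _).trans (le_of_eq (Finset.sum_congr rfl fun C' _ => abs_mul _ _))
    _ ≤ ∑ C' : vPlus d n dφ dplus, (tayXConst (rep C'.1) a₀ w pΦ 𝔥 R * T) *
          ((X.card : ℝ)⁻¹ * sGeo d n dφ dplus a₀ w pΦ 𝔥 R * wtC dφ dplus 𝔥 R C' / wtC dφ dplus 𝔥 R C) :=
        Finset.sum_le_sum fun C' _ => mul_le_mul (abs_alphaVec_le hA h𝔥 hR ha₀ hw hwin hM hU hFU hFs C')
          (abs_Bmat_inv_le hA hX hXne h𝔥 hR hpΦ ha₀ hw hwin hM hKM hXbox C' C) (abs_nonneg _)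
          ((abs_nonneg _).trans (abs_alphaVec_le hA h𝔥 hR ha₀ hw hwin hM hU hFU hFs C'))
    _ = T * (X.card : ℝ)⁻¹ * sGeo d n dφ dplus a₀ w pΦ 𝔥 R *
          (∑ C' : vPlus d n dφ dplus, tayXConst (rep C'.1) a₀ w pΦ 𝔥 R * wtC dφ dplus 𝔥 R C') / wtC dφ dplus 𝔥 R C := by
        rw [div_eq_mul_inv, Finset.mul_sum, Finset.sum_mul]
        refine Finset.sum_congr rfl fun C' _ => ?_
        have := (hwpos C).ne'
        field_simp
    _ = _ := by rfl

/-- **[BS-rg-loc] Proposition 1.4.5 / (prop:LTsymXYbd)**: `‖Loc_{X,Y}F‖_{T_0(𝔥,R)} ≤ C̄'(|Y|/|X|)‖F‖_{T_0(𝔥,R)}`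
for `F ∈ 𝒩(U)`, `X ≠ ∅` with `X` (and its reach) and `U` inside the box of radius `a₀` around `a`,
`C̄' = locBdConst` (explicit; `O(1)` when `a₀, w ≍ R`): "`‖Loc_{X,Y}F‖_{T_0} ≤ ‖F‖_{T_0}(|Y|/|X|)
Σ_{m,m'}‖f_{m'}^{(a)}‖_{Φ(U)}|A^{-1}_{m'm}|‖P̂_{m,0}‖_{T_0}`". [cite: BrydgesSlade2015RGII, Proposition 1.4.5 and Proposition (prop:LTsymXYbd), §2.2 (display (e:LTXYB5))] -/
theorem TphiNorm_locXY_zero_le (hA : LocAdm M n pN dφ dplus) (hX : InPatch a ⌊dplus⌋₊ X) (hXne : X.Nonempty)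
    (h𝔥 : 0 < 𝔥) (hR : 0 < R) (hpΦ : ⌊dplus⌋₊ ≤ pΦ) (ha₀ : 1 ≤ a₀) (hw : 1 ≤ w)
    (hwin : 2 * ((a₀ : ℤ) + pΦ * (w - 1 : ℕ)) < (M : ℤ) - 2 * pΦ)
    (hM : ((((a₀ + pΦ * (w - 1) + pΦ : ℕ) : ℤ) + pΦ * ⌊dplus / dφ⌋₊) + pΦ * ⌊dplus / dφ⌋₊ + 1) * 2 ≤ (M : ℤ))
    (hKM : 2 * ((⌊dplus⌋₊ : ℤ) + 1) < M) (hXbox : ∀ x ∈ X, ∀ j, cycDist (a j) (x j) + ⌊dplus⌋₊ ≤ a₀)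
    {U : Finset (TorusSite d M)} (hU : ∀ x ∈ U, ∀ j, cycDist (a j) (x j) ≤ a₀)
    {F : (TorusSite d M → Fin n → ℝ) → ℝ} (hFU : DependsOn U F) (hFs : ContDiff ℝ ∞ F) (Y : Finset (TorusSite d M)) :
    TphiNorm pN (latticeFamily (unitStep d M) 𝔥 R pΦ) (basisDir d M n) (locXY pN dφ dplus a X Y F) 0 ≤
      locBdConst d n dφ dplus a₀ w pΦ 𝔥 R * ((Y.card : ℝ) / X.card) *
        TphiNorm pN (latticeFamily (unitStep d M) 𝔥 R pΦ) (basisDir d M n) F 0 := by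
  set T := TphiNorm pN (latticeFamily (unitStep d M) 𝔥 R pΦ) (basisDir d M n) F 0 with hT
  have hT0 : 0 ≤ T := TphiNorm_nonneg _ _ _ _ _
  have hwpos : ∀ C'' : vPlus d n dφ dplus, 0 < wtC dφ dplus 𝔥 R C'' := fun C'' => wtC_pos h𝔥 hR C''
  -- coefficient family of the finite sum
  have hph : ∀ C : vPlus d n dφ dplus, ContDiff ℝ ∞ (fun φ : TorusSite d M → Fin n → ℝ =>
      betaVec pN dφ dplus a X F C * phatX (rep C.1) Y φ) := fun C => contDiff_const.mul (contDiff_phatX _ Y)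
  have e : coeffFamily (basisDir d M n) (locXY pN dφ dplus a X Y F) 0 =
      fun z => ∑ C : vPlus d n dφ dplus, coeffFamily (basisDir d M n) (fun φ => betaVec pN dφ dplus a X F C * phatX (rep C.1) Y φ) 0 z := by
    funext z
    simp only [coeffFamily]
    rw [show locXY pN dφ dplus a X Y F = fun φ => ∑ C : vPlus d n dφ dplus, betaVec pN dφ dplus a X F C * phatX (rep C.1) Y φ from rfl,
      coeff_finset_sum _ _ (fun C _ => hph C) z]
  have hstep1 : TphiNorm pN (latticeFamily (unitStep d M) 𝔥 R pΦ) (basisDir d M n) (locXY pN dφ dplus a X Y F) 0 ≤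
      ∑ C : vPlus d n dφ dplus, |betaVec pN dφ dplus a X F C| *
        TphiNorm pN (latticeFamily (unitStep d M) 𝔥 R pΦ) (basisDir d M n) (phatX (rep C.1) Y) 0 := by
    unfold TphiNorm
    rw [e]
    refine (Tnorm_sum_le (latticeFamily_evalBound (unitStep d M) h𝔥 hR pΦ pN (ι := Fin n)) _ _).trans
      (Finset.sum_le_sum fun C _ => ?_)
    exact TphiNorm_const_mul_le h𝔥 hR pΦ pN _ (contDiff_phatX _ Y) 0
  refine hstep1.trans ?_
  have hbound : ∀ C : vPlus d n dφ dplus,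
      |betaVec pN dφ dplus a X F C| * TphiNorm pN (latticeFamily (unitStep d M) 𝔥 R pΦ) (basisDir d M n) (phatX (rep C.1) Y) 0 ≤
        T * (X.card : ℝ)⁻¹ * sGeo d n dφ dplus a₀ w pΦ 𝔥 R * kZero d n dφ dplus a₀ w pΦ 𝔥 R * Y.card := by
    intro C
    have hrepC := rep_mem_vbarPlus hA.pos C.2
    obtain ⟨-, hordC⟩ := bounds_of_mem_vbarPlus hrepC
    have h1 := abs_betaVec_le hA hX hXne h𝔥 hR hpΦ ha₀ hw hwin hM hKM hXbox hU hFU hFs C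
    have h2 := TphiNorm_phatX_zero_le h𝔥 hR hA.one_le (rep C.1) (fun c hc => (hordC c hc).trans hpΦ) Y (pΦ := pΦ)
    have hβ0 : 0 ≤ T * (X.card : ℝ)⁻¹ * sGeo d n dφ dplus a₀ w pΦ 𝔥 R * kZero d n dφ dplus a₀ w pΦ 𝔥 R / wtC dφ dplus 𝔥 R C :=
      (abs_nonneg _).trans h1
    calc |betaVec pN dφ dplus a X F C| * TphiNorm pN (latticeFamily (unitStep d M) 𝔥 R pΦ) (basisDir d M n) (phatX (rep C.1) Y) 0
        ≤ (T * (X.card : ℝ)⁻¹ * sGeo d n dφ dplus a₀ w pΦ 𝔥 R * kZero d n dφ dplus a₀ w pΦ 𝔥 R / wtC dφ dplus 𝔥 R C) *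
            (Y.card * (𝔥 ^ (rep C.1).length * (R ^ tordF (rep C.1))⁻¹)) :=
          mul_le_mul h1 h2 (TphiNorm_nonneg _ _ _ _ _) hβ0
      _ = T * (X.card : ℝ)⁻¹ * sGeo d n dφ dplus a₀ w pΦ 𝔥 R * kZero d n dφ dplus a₀ w pΦ 𝔥 R * Y.card := by
          have := (hwpos C).ne'
          unfold wtC at this ⊢
          field_simp
  refine (Finset.sum_le_sum fun C _ => hbound C).trans (le_of_eq ?_)
  rw [Finset.sum_const, Finset.card_univ, nsmul_eq_mul]
  unfold locBdConst
  have hc : (X.card : ℝ) ≠ 0 := by exact_mod_cast (Finset.card_pos.2 hXne).ne'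
  field_simp


end Estimates

end Loc

end LongRangePhi4

end Literature.Barriers.CriticalPhenomena
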